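import Mathlib.Tactic.Group
import Summits.MatrixMultiplication.MatrixMultiplication.Theses.GelfandPairHosts
import Summits.MatrixMultiplication.MatrixMultiplication.Theorems.GelfandPairHostsAssembly
import Summits.MatrixMultiplication.MatrixMultiplication.Theorems.GelfandPairHostsRankFormula
import Summits.MatrixMultiplication.MatrixMultiplication.Theorems.GelfandPairHostsKillGlue

/-!
# Crux `GelfandHosting` (stmt-MatrixMultiplication-7381) — redirect strategist r1 companion

Kernel-checked companion of `Cruxes/GelfandHosting/STRATEGY-CENSUS-r1.md`
(seat `planner-cstrat-stmt-MatrixMultiplication-7381-r1-0`, 2026-08-17).  No `sorry`, no new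
definitions.

* §1 `summit_of_gelfandHosting : GelfandHosting → MatrixMultiplication` — the theorem that makes the
  crux summit-strength (`C → S`), assembled from the LANDED `gelfandPairHosts_assembly_proof`
  (stmt-7389) and `rankFormula_proof` (stmt-7385).  (The converse `S → C` is not expected: the route
  itself bets on `¬C`.)
* §2 `normalAbelian_design_capacity` — the GENERAL-DESIGN normal-abelian capacity theorem (new):
  if an abelian normal subgroup `A ⊴ G` acts freely on `X` with orbit labelling `blk : X → W`
  (coordinates `crd x ∈ A`, `crd x • base (blk x) = x`), and `C ≤ G` centralises `A`, then EVERY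
  module-TPP design `(φ, ψ, χ)` of size `(a,b,c)` — not only quotient-form ones — satisfies
  `a·b·c ≤ [G:C]²·|W|²·|X|`.  With `C = A` regular (`W = Unit`) this is `abc ≤ N·[G:A]²` for ALL designs
  in affine hosts `A ⋊ K ↷ A` (`regularNormalAbelian_design_capacity`), i.e. the route's support
  `AffineCapacity` (stmt-7387, quotient form) and `Negative/AbelianIndex` extended to general designs;
  with `A` = a `K`-invariant subgroup `F` of an affine host it is `abc ≤ N·(|E/F|·|K^F|)² = N·θ_aff²`
  for general designs (the lead's EVIDENCE-affine §3 quantity), so the affine reduction to the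
  orbit-BFC question Q now bounds the CRUX, not only stub 3 of line `birth`.
-/

set_option linter.dupNamespace false

namespace Summit.MatrixMultiplication.MatrixMultiplication.Cruxes.GelfandHosting.StrategistR1

open Summit.MatrixMultiplication.MatrixMultiplication.Theses.GelfandPairHosts

/-! ## §1 The crux is summit-strength: `C → S` from landed theorems -/

/-- **`GelfandHosting → ω(ℂ) = 2`.**  The route's deciding theorem `closes` needs the target
`GelfandHosting` and the support `RankFormula`; the latter is PROVED in the tree
(`Theorems.rankFormula_proof`, stmt-7385), and `Theorems.gelfandPairHosts_assembly_proof` (stmt-7389)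
is `closes` itself.  Hence the crux alone implies the summit. -/
theorem summit_of_gelfandHosting : GelfandHosting → MatrixMultiplication := fun h =>
  (show GelfandHosting → RankFormula → MatrixMultiplication from
    Summit.MatrixMultiplication.MatrixMultiplication.Theorems.gelfandPairHosts_assembly_proof) h
    Summit.MatrixMultiplication.MatrixMultiplication.Theorems.rankFormula_proof

/-! ## §2 The normal-abelian capacity theorem for GENERAL designs -/

section Capacity

variable {G : Type} [Group G] [Fintype G] {X : Type} [Fintype X] [MulAction G X]
variable {W : Type} [Fintype W]

/-- **Normal-abelian capacity bound for general module-TPP designs.**  Let `G ↷ X`; let `A ≤ G` be a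
subgroup that is normal (`g a g⁻¹ ∈ A`), commutative, and acts FREELY on `X`; let `blk : X → W` be
constant on `A`-orbits and `base : W → X`, `crd : X → G` an orbit presentation (`crd x ∈ A`,
`crd x • base (blk x) = x`); let `C ≤ G` centralise `A`.  Then every module-TPP design
`φ : [a]×[b] → G`, `ψ : [b]×[c] → X`, `χ : [a]×[c] → X`
(`φ(i,j) • ψ(j',k) = χ(i',k') ↔ (i,j,k) = (i',j',k')`) has `a·b·c ≤ [G:C]²·|W|²·|X|`.
Injection `(i,j,k) ↦ (φ(i,j)C, φ(i₀,j)C, blk ψ(j,k), blk χ(i,k), (φ(i₀,j) φ(i,j)⁻¹ τ) • χ(i,k))` with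
`τ = crd (φ(i,j) • base (blk ψ(j,k)))` the translation part of `φ(i,j)` on the block of `ψ(j,k)`:
a collision forces `φ(i,j) • ψ(j',k) = χ(i',k')`. [folklore] -/
theorem normalAbelian_design_capacity (A C : Subgroup G)
    (hN : ∀ (g a : G), a ∈ A → g * a * g⁻¹ ∈ A)
    (hcomm : ∀ a ∈ A, ∀ a' ∈ A, a * a' = a' * a)
    (hCA : ∀ z ∈ C, ∀ a ∈ A, z * a = a * z)
    (hfree : ∀ a ∈ A, ∀ x : X, a • x = x → a = 1)
    (blk : X → W) (base : W → X) (crd : X → G)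
    (hcrdA : ∀ x, crd x ∈ A) (hrec : ∀ x, crd x • base (blk x) = x)
    (hblk : ∀ a ∈ A, ∀ x : X, blk (a • x) = blk x)
    {a b c : ℕ} (φ : Fin a × Fin b → G) (ψ : Fin b × Fin c → X) (χ : Fin a × Fin c → X)
    (hdes : ∀ (i i' : Fin a) (j j' : Fin b) (k k' : Fin c),
      φ (i, j) • ψ (j', k) = χ (i', k') ↔ (i = i' ∧ j = j' ∧ k = k')) :
    a * b * c ≤ C.index ^ 2 * Fintype.card W ^ 2 * Fintype.card X := by
  classical
  -- trivial when there is no row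
  rcases Nat.eq_zero_or_pos a with ha | ha
  · subst ha; simp
  let i₀ : Fin a := ⟨0, ha⟩
  haveI : Fintype (G ⧸ C) := Fintype.ofFinite (G ⧸ C)
  -- normality with the inverse on the left
  have hN' : ∀ (g a : G), a ∈ A → g⁻¹ * a * g ∈ A := fun g a ha => by
    simpa using hN g⁻¹ a ha
  -- freeness: two elements of `A` with the same action on one point are equal
  have free2 : ∀ (u v : G) (x : X), u ∈ A → v ∈ A → u • x = v • x → u = v := by
    intro u v x hu hv huv
    have h1 : (v⁻¹ * u) • x = x := by rw [mul_smul, huv, inv_smul_smul]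
    have h2 := hfree (v⁻¹ * u) (A.mul_mem (A.inv_mem hv) hu) x h1
    calc u = v * (v⁻¹ * u) := by group
      _ = v := by rw [h2, mul_one]
  -- two points with the same label differ by the quotient of their coordinates
  have sameblk : ∀ x x' : X, blk x = blk x' → x' = (crd x' * (crd x)⁻¹) • x := by
    intro x x' hxx
    calc x' = crd x' • base (blk x') := (hrec x').symm
      _ = crd x' • base (blk x) := by rw [hxx]
      _ = (crd x' * (crd x)⁻¹) • (crd x • base (blk x)) := by
          rw [smul_smul, inv_mul_cancel_right]
      _ = (crd x' * (crd x)⁻¹) • x := by rw [hrec x]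
  -- the label of a base point
  have blk_base : ∀ x : X, blk (base (blk x)) = blk x := by
    intro x
    conv_rhs => rw [← hrec x]
    rw [hblk _ (hcrdA x)]
  -- how a group element acts in coordinates
  have act : ∀ (g : G) (x : X), g • x =
      (g * crd x * g⁻¹ * crd (g • base (blk x))) • base (blk (g • base (blk x))) := by
    intro g x
    conv_lhs => rw [← hrec x]
    rw [mul_smul, hrec (g • base (blk x)), smul_smul, smul_smul]
    congr 1
    group
  have memact : ∀ (g : G) (x : X), g * crd x * g⁻¹ * crd (g • base (blk x)) ∈ A :=
    fun g x => A.mul_mem (hN g _ (hcrdA x)) (hcrdA _)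
  -- the block of `g • x` depends only on the block of `x`
  have blk_act : ∀ (g : G) (x : X), blk (g • x) = blk (g • base (blk x)) := by
    intro g x
    conv_lhs => rw [act g x]
    rw [hblk _ (memact g x), blk_base]
  have blk_act' : ∀ (g : G) (x x' : X), blk x = blk x' → blk (g • x) = blk (g • x') := by
    intro g x x' h
    rw [blk_act g x, blk_act g x', h]
  have blk_inj : ∀ (g : G) (x x' : X), blk (g • x) = blk (g • x') → blk x = blk x' := by
    intro g x x' h
    have := blk_act' g⁻¹ (g • x) (g • x') h
    simpa using this
  -- the coordinate of `g • x`
  have crd_act : ∀ (g : G) (x : X),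
      crd (g • x) = g * crd x * g⁻¹ * crd (g • base (blk x)) := by
    intro g x
    apply free2 _ _ (base (blk (g • x))) (hcrdA _) (memact g x)
    rw [hrec (g • x), blk_act g x]
    exact act g x
  -- same coset of `C` ⇒ same conjugation action on `A`
  have conj_eq : ∀ g g' : G, (g : G ⧸ C) = g' → ∀ u ∈ A, g * u * g⁻¹ = g' * u * g'⁻¹ := by
    intro g g' hgg u hu
    have hz : g⁻¹ * g' ∈ C := QuotientGroup.eq.mp hgg
    have hc := hCA _ hz u hu
    calc g * u * g⁻¹ = g * (u * (g⁻¹ * g')) * g'⁻¹ := by group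
      _ = g * ((g⁻¹ * g') * u) * g'⁻¹ := by rw [hc]
      _ = g' * u * g'⁻¹ := by group
  have conj_eq' : ∀ g g' : G, (g : G ⧸ C) = g' → ∀ u ∈ A, g⁻¹ * u * g = g'⁻¹ * u * g' := by
    intro g g' hgg u hu
    have h := conj_eq g g' hgg (g'⁻¹ * u * g') (hN' g' u hu)
    have h' : g * (g'⁻¹ * u * g') * g⁻¹ = u := by rw [h]; group
    calc g⁻¹ * u * g = g⁻¹ * (g * (g'⁻¹ * u * g') * g⁻¹) * g := by rw [h']
      _ = g'⁻¹ * u * g' := by group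
  -- the diagonal of the design
  have diag : ∀ (i : Fin a) (j : Fin b) (k : Fin c), φ (i, j) • ψ (j, k) = χ (i, k) :=
    fun i j k => (hdes i i j j k k).mpr ⟨rfl, rfl, rfl⟩
  -- translation part of `φ(i,j)` on the block of `ψ(j,k)`
  let τ : Fin a → Fin b → Fin c → G := fun i j k => crd (φ (i, j) • base (blk (ψ (j, k))))
  have hτA : ∀ i j k, τ i j k ∈ A := fun i j k => hcrdA _
  -- the injection
  let F : Fin a × Fin b × Fin c → (G ⧸ C) × (G ⧸ C) × W × W × X := fun t =>
    ((φ (t.1, t.2.1) : G ⧸ C), (φ (i₀, t.2.1) : G ⧸ C), blk (ψ (t.2.1, t.2.2)),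
      blk (χ (t.1, t.2.2)),
      (φ (i₀, t.2.1) * (φ (t.1, t.2.1))⁻¹ * τ t.1 t.2.1 t.2.2) • χ (t.1, t.2.2))
  have hinj : Function.Injective F := by
    rintro ⟨i, j, k⟩ ⟨i', j', k'⟩ heq
    simp only [F, Prod.mk.injEq] at heq
    obtain ⟨e1, e2, e3, e4, e5⟩ := heq
    -- notation
    set g := φ (i, j) with hg
    set g' := φ (i', j') with hg'
    set g₀ := φ (i₀, j) with hg₀
    set g₀' := φ (i₀, j') with hg₀'
    set q := ψ (j, k) with hq
    set p := ψ (j', k') with hp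
    set p₁ := ψ (j', k) with hp₁
    have hτ : τ i j k = crd (g • base (blk q)) := rfl
    have hτ' : τ i' j' k' = crd (g' • base (blk p)) := rfl
    set T := τ i j k with hT
    set T' := τ i' j' k' with hT'
    have hTA : T ∈ A := hτA i j k
    have hT'A : T' ∈ A := hτA i' j' k'
    -- (5) the two reference points `χ(i₀,k)`, `χ(i₀,k')` lie in one block
    have hPblk : ∀ (ii : Fin a) (jj : Fin b) (kk : Fin c),
        blk ((φ (i₀, jj) * (φ (ii, jj))⁻¹ * τ ii jj kk) • χ (ii, kk)) = blk (χ (i₀, kk)) := by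
      intro ii jj kk
      rw [mul_smul, mul_smul, ← diag i₀ jj kk]
      apply blk_act'
      rw [blk_act' (φ (ii, jj))⁻¹ (τ ii jj kk • χ (ii, kk)) (χ (ii, kk)) (hblk _ (hτA ii jj kk) _),
        ← diag ii jj kk, inv_smul_smul]
    have e6 : blk (χ (i₀, k)) = blk (χ (i₀, k')) := by
      rw [← hPblk i j k, ← hPblk i' j' k', e5]
    -- (6) hence `ψ(j',k)` lies in the block of `ψ(j',k')` (= block of `ψ(j,k)`)
    have e7 : blk p₁ = blk p := by
      apply blk_inj g₀'
      rw [hp₁, hp, hg₀', diag, diag]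
      exact e6
    -- (7) so `ψ(j',k) = w • ψ(j',k')` with `w ∈ A`
    set w := crd p₁ * (crd p)⁻¹ with hw
    have hwA : w ∈ A := A.mul_mem (hcrdA _) (A.inv_mem (hcrdA _))
    have e8 : p₁ = w • p := sameblk p p₁ e7.symm
    -- (8) `g • p = (T T'⁻¹) • (g' • p)`
    have eblk : blk (g • base (blk p)) = blk (g' • base (blk p)) := by
      have h1 : blk (g • base (blk p)) = blk (χ (i, k)) := by
        have hh : χ (i, k) = g • q := (diag i j k).symm
        rw [hh, blk_act g q, e3]
      have h2 : blk (g' • base (blk p)) = blk (χ (i', k')) := by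
        have hh : χ (i', k') = g' • p := (diag i' j' k').symm
        rw [hh, blk_act g' p]
      rw [h1, h2, e4]
    have e9 : g • p = (T * T'⁻¹) • (g' • p) := by
      rw [act g p, act g' p, smul_smul, eblk]
      congr 1
      rw [← hτ', ← e3, ← hτ, conj_eq g g' e1 _ (hcrdA p)]
      -- `T T'⁻¹ (g' y g'⁻¹ T') = g' y g'⁻¹ T`, a computation in the abelian group `A`
      have hy : g' * crd p * g'⁻¹ ∈ A := hN g' _ (hcrdA p)
      have c1 := hcomm _ (A.mul_mem hTA (A.inv_mem hT'A)) _ hy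
      calc g' * crd p * g'⁻¹ * T = (g' * crd p * g'⁻¹) * (T * T'⁻¹) * T' := by group
        _ = (T * T'⁻¹) * (g' * crd p * g'⁻¹) * T' := by rw [← c1]
        _ = T * T'⁻¹ * (g' * crd p * g'⁻¹ * T') := by group
    -- (9) the point identity `e5` pins down `g w g⁻¹`
    have e10 : g * w * g⁻¹ = T⁻¹ * T' := by
      -- rewrite both sides of `e5` as elements of `A` acting on `χ(i₀,k')`
      have lhs : (g₀ * g⁻¹ * T) • χ (i, k) = (g₀ * (g⁻¹ * T * g) * g₀⁻¹ * (g₀' * w * g₀'⁻¹)) • χ (i₀, k') := by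
        have h1 : χ (i, k) = g • q := (diag i j k).symm
        have h2 : q = g₀⁻¹ • χ (i₀, k) := by rw [← diag i₀ j k, ← hg₀, inv_smul_smul]
        have h3 : χ (i₀, k) = g₀' • p₁ := by rw [hp₁, hg₀', diag]
        have h4 : χ (i₀, k') = g₀' • p := by rw [hp, hg₀', diag]
        rw [h1, h2, h3, e8, h4]
        simp only [smul_smul]
        congr 1
        group
      have rhs : (g₀' * g'⁻¹ * T') • χ (i', k') = (g₀' * (g'⁻¹ * T' * g') * g₀'⁻¹) • χ (i₀, k') := by
        have h1 : χ (i', k') = g' • p := (diag i' j' k').symm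
        have h4 : p = g₀'⁻¹ • χ (i₀, k') := by rw [← diag i₀ j' k', ← hg₀', inv_smul_smul]
        rw [h1, h4]
        simp only [smul_smul]
        congr 1
        group
      have huA : g⁻¹ * T * g ∈ A := hN' g T hTA
      have hu'A : g'⁻¹ * T' * g' ∈ A := hN' g' T' hT'A
      have hvA : g₀ * (g⁻¹ * T * g) * g₀⁻¹ ∈ A := hN g₀ _ huA
      have hxA : g₀' * w * g₀'⁻¹ ∈ A := hN g₀' _ hwA
      have hv'A : g₀' * (g'⁻¹ * T' * g') * g₀'⁻¹ ∈ A := hN g₀' _ hu'A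
      have key := free2 _ _ (χ (i₀, k')) (A.mul_mem hvA hxA) hv'A (by rw [← lhs, ← rhs]; exact e5)
      -- move the conjugations across with `conj_eq`
      rw [conj_eq g₀ g₀' e2 _ huA] at key
      have key2 : g⁻¹ * T * g * w = g'⁻¹ * T' * g' := by
        have : g₀' * (g⁻¹ * T * g * w) * g₀'⁻¹ = g₀' * (g'⁻¹ * T' * g') * g₀'⁻¹ := by
          rw [← key]; group
        exact mul_left_cancel (mul_right_cancel this)
      rw [← conj_eq' g g' e1 T' hT'A] at key2
      calc g * w * g⁻¹ = T⁻¹ * (g * (g⁻¹ * T * g * w) * g⁻¹) := by group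
        _ = T⁻¹ * (g * (g⁻¹ * T' * g) * g⁻¹) := by rw [key2]
        _ = T⁻¹ * T' := by group
    -- (10) therefore `g • ψ(j',k) = χ(i',k')`, which the design forbids unless the triples agree
    have viol : g • p₁ = χ (i', k') := by
      have c2 := hcomm T' hT'A T hTA
      have hone : T⁻¹ * T' * (T * T'⁻¹) = 1 := by
        calc T⁻¹ * T' * (T * T'⁻¹) = T⁻¹ * (T' * T) * T'⁻¹ := by group
          _ = T⁻¹ * (T * T') * T'⁻¹ := by rw [c2]
          _ = 1 := by group
      have hd : g' • p = χ (i', k') := diag i' j' k'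
      calc g • p₁ = (g * w) • p := by rw [e8, smul_smul]
        _ = (g * w * g⁻¹) • (g • p) := by rw [smul_smul]; congr 1; group
        _ = (g * w * g⁻¹ * (T * T'⁻¹)) • (g' • p) := by rw [e9, smul_smul]
        _ = χ (i', k') := by rw [e10, hone, one_smul, hd]
    obtain ⟨r1, r2, r3⟩ := (hdes i i' j j' k k').mp viol
    subst r1 r2 r3
    rfl
  have hcardq : Fintype.card (G ⧸ C) = C.index := by
    rw [Subgroup.index, Nat.card_eq_fintype_card]
  have h := Fintype.card_le_of_injective F hinj
  simp only [Fintype.card_prod, Fintype.card_fin, hcardq] at h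
  calc a * b * c = a * (b * c) := by ring
    _ ≤ _ := h
    _ = C.index ^ 2 * Fintype.card W ^ 2 * Fintype.card X := by ring

/-- **Affine / regular-normal-abelian hosts, general designs.**  If an abelian normal subgroup
`A ⊴ G` acts freely and transitively on `X` (`crd x ∈ A`, `crd x • x₀ = x`) — e.g. the translations of
an affine host `A ⋊ K ↷ A`, `[G:A] = |K|` — then EVERY module-TPP design has `a·b·c ≤ [G:A]²·|X|`.
(The route's `AffineCapacity`, stmt-7387, and `Negative/AbelianIndex` give this for quotient-form
designs only; `Negative/CommutingAction` gives `|X/X^K|²·|X|`, useless for fixed-point-free `K`.)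
[folklore] -/
theorem regularNormalAbelian_design_capacity (A : Subgroup G)
    (hN : ∀ (g a : G), a ∈ A → g * a * g⁻¹ ∈ A)
    (hcomm : ∀ a ∈ A, ∀ a' ∈ A, a * a' = a' * a)
    (hfree : ∀ a ∈ A, ∀ x : X, a • x = x → a = 1)
    (x₀ : X) (crd : X → G) (hcrdA : ∀ x, crd x ∈ A) (hrec : ∀ x, crd x • x₀ = x)
    {a b c : ℕ} (φ : Fin a × Fin b → G) (ψ : Fin b × Fin c → X) (χ : Fin a × Fin c → X)
    (hdes : ∀ (i i' : Fin a) (j j' : Fin b) (k k' : Fin c),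
      φ (i, j) • ψ (j', k) = χ (i', k') ↔ (i = i' ∧ j = j' ∧ k = k')) :
    a * b * c ≤ A.index ^ 2 * Fintype.card X := by
  have h := normalAbelian_design_capacity (W := Unit) A A hN hcomm
    (fun z hz u hu => hcomm z hz u hu) hfree (fun _ => ()) (fun _ => x₀) crd hcrdA
    (fun x => hrec x) (fun _ _ _ => rfl) φ ψ χ hdes
  simpa using h

/-- **Witness shape for the crux (normal-abelian form).**  Let `(G ↷ X, φ, ψ, χ)` satisfy the
`∃`-body of `GelfandHosting` at exponent `ε` — multiplicity-free host, module-TPP design of size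
`(a,b,c)` with `b, c ≥ 1`, `D = dim span{P_g} ≤ (abc)^{(2+ε)/3}` — and let `A ⊴ G` be an abelian
normal subgroup acting freely with orbit presentation `(blk : X → W, base, crd)`, `C` a subgroup
centralising `A`.  Then `N³ ≤ ([G:C]²·|W|²·N)^{2+ε}` (`N = |X|`), i.e. `θ := [G:C]·|W| ≥
N^{(1-ε)/(4+2ε)}`: multiplicity-free ⇒ transitive ⇒ `N ≤ D ≤ (abc)^{(2+ε)/3}` (KillGlue lemmas) and
`abc ≤ [G:C]²|W|²N` (`normalAbelian_design_capacity`).  For an affine host with a `K`-invariant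
subgroup `F ≤ E` (`A = F`, `C = E ⋊ C_K(F)`, `W = E/F`) this reads `|E/F|·|K^F| ≥ N^{(1-ε)/(4+2ε)}`:
GENERAL-design crux witnesses in affine hosts need `θ_aff ≥ N^{1/4-O(ε)}`. [folklore] -/
theorem gelfandHosting_witness_normalAbelian [DecidableEq X] (A C : Subgroup G)
    (hN : ∀ (g a : G), a ∈ A → g * a * g⁻¹ ∈ A)
    (hcomm : ∀ a ∈ A, ∀ a' ∈ A, a * a' = a' * a)
    (hCA : ∀ z ∈ C, ∀ a ∈ A, z * a = a * z)
    (hfree : ∀ a ∈ A, ∀ x : X, a • x = x → a = 1)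
    (blk : X → W) (base : W → X) (crd : X → G)
    (hcrdA : ∀ x, crd x ∈ A) (hrec : ∀ x, crd x • base (blk x) = x)
    (hblk : ∀ a ∈ A, ∀ x : X, blk (a • x) = blk x)
    {a b c : ℕ} (φ : Fin a × Fin b → G) (ψ : Fin b × Fin c → X) (χ : Fin a × Fin c → X)
    (j₀ : Fin b) (k₀ : Fin c) (ε : ℝ) (hε : 0 < ε)
    (hmf : ∀ M M' : Matrix X X ℂ, (∀ (g : G) (x y : X), M (g • x) (g • y) = M x y) →
      (∀ (g : G) (x y : X), M' (g • x) (g • y) = M' x y) → M * M' = M' * M)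
    (hdes : ∀ (i i' : Fin a) (j j' : Fin b) (k k' : Fin c),
      φ (i, j) • ψ (j', k) = χ (i', k') ↔ (i = i' ∧ j = j' ∧ k = k'))
    (hD : (Module.finrank ℂ (Submodule.span ℂ (Set.range fun g : G =>
        Matrix.of fun y x : X => if g • x = y then (1 : ℂ) else 0)) : ℝ) ≤
      ((a * b * c : ℕ) : ℝ) ^ ((2 + ε) / 3)) :
    (Fintype.card X : ℝ) ^ (3 : ℝ) ≤
      ((C.index ^ 2 * Fintype.card W ^ 2 * Fintype.card X : ℕ) : ℝ) ^ (2 + ε) := by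
  have htrans : ∀ x y : X, ∃ g : G, g • x = y :=
    Summit.MatrixMultiplication.MatrixMultiplication.Theorems.killGlue_transitive_of_comm hmf
  have hNle : (Fintype.card X : ℝ) ≤ (Module.finrank ℂ (Submodule.span ℂ (Set.range fun g : G =>
      Matrix.of fun y x : X => if g • x = y then (1 : ℂ) else 0)) : ℝ) := by
    exact_mod_cast Summit.MatrixMultiplication.MatrixMultiplication.Theorems.killGlue_card_le_finrank
      (ψ (j₀, k₀)) htrans
  have hcap : ((a * b * c : ℕ) : ℝ) ≤ ((C.index ^ 2 * Fintype.card W ^ 2 * Fintype.card X : ℕ) : ℝ) := by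
    exact_mod_cast normalAbelian_design_capacity A C hN hcomm hCA hfree blk base crd hcrdA hrec hblk
      φ ψ χ hdes
  have hexp : 0 ≤ (2 + ε) / 3 := by positivity
  have h1 : (Fintype.card X : ℝ) ≤
      ((C.index ^ 2 * Fintype.card W ^ 2 * Fintype.card X : ℕ) : ℝ) ^ ((2 + ε) / 3) :=
    hNle.trans (hD.trans (Real.rpow_le_rpow (by positivity) hcap hexp))
  have h2 := Real.rpow_le_rpow (by positivity) h1 (show (0 : ℝ) ≤ 3 by norm_num)
  rw [← Real.rpow_mul (by positivity)] at h2
  have e : (2 + ε) / 3 * 3 = 2 + ε := by ring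
  rwa [e] at h2

end Capacity


/-! ## §3 The r1 decomposition candidate, typed (census §Decomposition, D-r1-1)

`ThetaRich G X` says: every free normal-abelian presentation of the host has
`[G:C]·|W| ≥ |X|^{1/4}` (no normal-abelian obstruction of size `N^{1/4}`).  The candidate split of
the crux is `ThetaRichHosts` (cheap θ-rich multiplicity-free hosts exist — pure group theory,
necessary for the crux up to the exponent bookkeeping of `gelfandHosting_witness_normalAbelian`)
and `DesignsFromTheta` (every such host carries a near-perfect design).  The seam
`decomposition_assembly` is modus ponens (PROVED below); the split fails clause (d) of the BC2
redirect test — no mechanism whatsoever is known for `DesignsFromTheta`, and no θ-rich near-linear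
host is known either (vacuity risk) — see the census. -/

section Decomposition

open Classical in
/-- The multiplicity-free / cost data of a host, in the crux's own inlined vocabulary. -/
noncomputable def HostCost (G : Type) [Group G] [Fintype G] (X : Type) [Fintype X] [DecidableEq X]
    [MulAction G X] : ℕ :=
  Module.finrank ℂ (Submodule.span ℂ (Set.range fun g : G =>
    Matrix.of fun y x : X => if g • x = y then (1 : ℂ) else 0))

/-- Multiplicity-freeness exactly as inlined in `GelfandHosting`. -/
def IsMF (G : Type) [Group G] (X : Type) [Fintype X] [DecidableEq X] [MulAction G X] : Prop :=
  ∀ A B : Matrix X X ℂ, (∀ (g : G) (x y : X), A (g • x) (g • y) = A x y) →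
    (∀ (g : G) (x y : X), B (g • x) (g • y) = B x y) → A * B = B * A

/-- `θ`-richness: no free normal-abelian presentation `(A, C, blk, base, crd)` of the host has
`[G:C]·|W| < |X|^{1/4}`. -/
def ThetaRich (G : Type) [Group G] [Fintype G] (X : Type) [Fintype X] [MulAction G X] : Prop :=
  ∀ (A C : Subgroup G) (W : Type) (_ : Fintype W) (blk : X → W) (base : W → X) (crd : X → G),
    (∀ (g a : G), a ∈ A → g * a * g⁻¹ ∈ A) → (∀ a ∈ A, ∀ a' ∈ A, a * a' = a' * a) →
    (∀ z ∈ C, ∀ a ∈ A, z * a = a * z) → (∀ a ∈ A, ∀ x : X, a • x = x → a = 1) →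
    (∀ x, crd x ∈ A) → (∀ x, crd x • base (blk x) = x) → (∀ a ∈ A, ∀ x : X, blk (a • x) = blk x) →
    (Fintype.card X : ℝ) ^ (1 / 4 : ℝ) ≤ (C.index * Fintype.card W : ℕ)

/-- **X₁ (existence piece).** For every `ε > 0` there is a θ-rich multiplicity-free host with
`|X| ≥ 2` and cost `D ≤ |X|^{1+ε}`. -/
def ThetaRichHosts : Prop :=
  ∀ ε : ℝ, 0 < ε → ∃ (G : Type) (_ : Group G) (_ : Fintype G) (X : Type) (_ : Fintype X)
    (_ : DecidableEq X) (_ : MulAction G X), IsMF G X ∧ 2 ≤ Fintype.card X ∧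
    (HostCost G X : ℝ) ≤ (Fintype.card X : ℝ) ^ (1 + ε) ∧ ThetaRich G X

/-- **X₂ (design piece).** Every θ-rich multiplicity-free host with `|X| ≥ 2` and `D ≤ |X|^{1+ε}`
carries a module-TPP design with `abc ≥ 2` and `D ≤ (abc)^{(2+ε)/3}`. -/
def DesignsFromTheta : Prop :=
  ∀ ε : ℝ, 0 < ε → ∀ (G : Type) [Group G] [Fintype G] (X : Type) [Fintype X] [DecidableEq X]
    [MulAction G X], IsMF G X → 2 ≤ Fintype.card X →
    (HostCost G X : ℝ) ≤ (Fintype.card X : ℝ) ^ (1 + ε) → ThetaRich G X →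
    ∃ (a b c : ℕ) (φ : Fin a × Fin b → G) (ψ : Fin b × Fin c → X) (χ : Fin a × Fin c → X),
      2 ≤ a * b * c ∧ (∀ (i i' : Fin a) (j j' : Fin b) (k k' : Fin c),
        φ (i, j) • ψ (j', k) = χ (i', k') ↔ (i = i' ∧ j = j' ∧ k = k')) ∧
      (HostCost G X : ℝ) ≤ ((a * b * c : ℕ) : ℝ) ^ ((2 + ε) / 3)

/-- The seam of the candidate split is modus ponens (a `trivial_seam` in BC2 terms). -/
theorem decomposition_assembly : ThetaRichHosts → DesignsFromTheta → GelfandHosting := by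
  intro h1 h2 ε hε
  obtain ⟨G, iG, iFG, X, iFX, iDX, iMA, hmf, h2le, hD, hθ⟩ := h1 ε hε
  obtain ⟨a, b, c, φ, ψ, χ, habc, hdes, hcost⟩ := h2 ε hε G X hmf h2le hD hθ
  exact ⟨G, iG, iFG, X, iFX, iDX, iMA, a, b, c, φ, ψ, χ, hmf, habc, hdes, hcost⟩

end Decomposition

end Summit.MatrixMultiplication.MatrixMultiplication.Cruxes.GelfandHosting.StrategistR1
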